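import Summits.Langlands.Langlands.Theorems.LevelOneDyadicFrame

/-!
Part 3/4 of the support module of the decomp-langlands lens-4 nodes g6 `LevelOneNormalForm` + g7 `DyadicCompanion` for
route-Langlands-MinimalLevelDescent rev 3 (crux Z = `MinimalLevelDescent.LevelOneCrystallineDescent`, stmt-Langlands-31277):
the 1239-line candidate `nodes/lens-4-g7-DyadicCompanion.module.lean` (rc 0 · 0 sorry) CUT by topic at the gate's request
(census REPLY 2026-08-30T09:08:07Z: theorem files ≤ 400 lines, statement-only file ≤ 1000, docstring on every decl), SAME namespace
`Summit.Langlands.Langlands.Theorems.LevelOneDyadic` in all four parts so that every kernel theorem keeps its name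
(`LevelOneDyadic.item_31277_of_pieces`, `…dyadicLevelOneCompanion_iff_pieces`, `…_of_langlands`).  0 sorry; axioms standard.

# Part 3 — THE TOWER MECHANISM OF K, NECESSITY, and the dyadic Satake/Frobenius bookkeeping:
`residualInertiaDescent_of_tower : SD → BC → T⁺ → K`, `automorphic_of_residual`, the necessity certificates Langlands ⟹ D, K, Z, W, L,
the g6 deciding theorems `langlands_of_KZ` / `langlands_of_tower_KZ`, and g7's `companionMatch_of_satake`, `eventually_satake_of_match`,
`exists_conj_of_match` (Chebotarev + Brauer–Nesbitt conjugacy of matched irreducible 2-adic representations).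
-/

set_option linter.dupNamespace false

namespace Summit.Langlands.Langlands.Theorems.LevelOneDyadic

open scoped NumberField
open Filter IsDedekindDomain Polynomial
open Literature.NumberTheory.GaloisRepresentations Literature.NumberTheory.Automorphic
open Summit.Langlands.Langlands.Theses

variable {K : Type} [Field K] [NumberField K] {ℓ : ℕ} [Fact ℓ.Prime] {n : ℕ}

/-- T⁺'s one-line text over tree declarations (the stub `stub_residualKillingTower` of the kit's line file), verbatim. -/
theorem residualKillingTower_iff : ResidualKillingTower ↔
    ∀ (K : Type) [Field K] [NumberField K] (n ℓ : ℕ) [Fact ℓ.Prime] (ρ : Literature.NumberTheory.GaloisRepresentations.FramedGaloisRep K (PadicAlgCl ℓ) n) (k : ℕ), ρ.toGaloisRep.IsIrreducible → ((∀ᶠ v : IsDedekindDomain.HeightOneSpectrum (NumberField.RingOfIntegers K) in cofinite, ρ.IsUnramifiedAt v) ∧ ∀ (v : IsDedekindDomain.HeightOneSpectrum (NumberField.RingOfIntegers K)) (hv : ((ℓ : ℕ) : NumberField.RingOfIntegers K) ∈ v.asIdeal), (Literature.NumberTheory.PAdicHodge.fontainePstAdicCompletion v ℓ hv).IsDeRhamFramed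 (ρ.toLocal v)) → (∀ (v : IsDedekindDomain.HeightOneSpectrum (NumberField.RingOfIntegers K)) (hv : ((ℓ : ℕ) : NumberField.RingOfIntegers K) ∈ v.asIdeal), (Literature.NumberTheory.PAdicHodge.fontainePstAdicCompletion v ℓ hv).IsCrystallineFramed (ρ.toLocal v)) → (∃ S : Finset (IsDedekindDomain.HeightOneSpectrum (NumberField.RingOfIntegers K)), S.card ≤ k ∧ ∀ v ∉ S, ((ℓ : ℕ) : NumberField.RingOfIntegers K) ∉ v.asIdeal → ρ.IsUnramifiedAt v) → (∃ w : IsDedekindDomain.HeightOneSpectrum (NumberField.RingOfIntegers K), ((ℓ : ℕ) : NumberField.RingOfIntegers K) ∉ w.asIdeal ∧ ¬ ρ.IsUnramifiedAt w) → ∃ (L : Type) (_ : Field L) (_ : NumberField L) (_ : Algebra K L) (M : Type) (_ : Field M) (_ : NumberField M) (_ : Algebra K M) (_ : Algebra L M) (_ : IsScalarTower K L M), IsGalois K M ∧ IsSolvable (M ≃ₐ[K] M) ∧ (ρ.restrictField L).toGaloisRep.IsIrreducible ∧ (ρ.restrictField M).toGaloisRep.IsIrreducible ∧ ((∀ᶠ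 v : IsDedekindDomain.HeightOneSpectrum (NumberField.RingOfIntegers L) in cofinite, (ρ.restrictField L).IsUnramifiedAt v) ∧ ∀ (v : IsDedekindDomain.HeightOneSpectrum (NumberField.RingOfIntegers L)) (hv : ((ℓ : ℕ) : NumberField.RingOfIntegers L) ∈ v.asIdeal), (Literature.NumberTheory.PAdicHodge.fontainePstAdicCompletion v ℓ hv).IsDeRhamFramed ((ρ.restrictField L).toLocal v)) ∧ (∀ (v : IsDedekindDomain.HeightOneSpectrum (NumberField.RingOfIntegers L)) (hv : ((ℓ : ℕ) : NumberField.RingOfIntegers L) ∈ v.asIdeal), (Literature.NumberTheory.PAdicHodge.fontainePstAdicCompletion v ℓ hv).IsCrystallineFramed ((ρ.restrictField L).toLocal v)) ∧ ((∃ S : Finset (IsDedekindDomain.HeightOneSpectrum (NumberField.RingOfIntegers L)), S.card ≤ k - 1 ∧ ∀ v ∉ S, ((ℓ : ℕ) : NumberField.RingOfIntegers L) ∉ v.asIdeal → (ρ.restrictField L).IsUnramifiedAt v) ∨ ((∃ S : Finset (IsDedekindDomain.HeightOneSpectrum (NumberField.RingOfIntegers L)), S.card ≤ k ∧ ∀ v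 ∉ S, ((ℓ : ℕ) : NumberField.RingOfIntegers L) ∉ v.asIdeal → (ρ.restrictField L).IsUnramifiedAt v) ∧ (∃ w' : IsDedekindDomain.HeightOneSpectrum (NumberField.RingOfIntegers L), ((ℓ : ℕ) : NumberField.RingOfIntegers L) ∉ w'.asIdeal ∧ ¬ (ρ.restrictField L).IsUnramifiedAt w' ∧ ∃ τ : Field.absoluteGaloisGroup L →* Matrix.GeneralLinearGroup (Fin n) (Literature.NumberTheory.GaloisRepresentations.padicAlgClResidueField ℓ), (ρ.restrictField L).IsResidualRepOf (RingHom.id (Literature.NumberTheory.GaloisRepresentations.padicAlgClResidueField ℓ)) τ ∧ ∀ 𝔓 ∈ w'.primesAbove, ∀ σ ∈ 𝔓.inertia (Field.absoluteGaloisGroup L), τ σ = 1))) :=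
  Iff.rfl

/-- Automorphic ⟹ residually automorphic, with P = Q the ℓ-integral Frobenius polynomial. [g4/g5, re-proved] -/
theorem isResiduallyAutomorphic_of_satakeCompatible (hcpt : isCompact_glFiniteIntegralLevel n K) (ι : PadicAlgCl ℓ ≃+* ℂ)
    (ρ : FramedGaloisRep K (PadicAlgCl ℓ) n)
    (h : ∃ π : CuspidalAutomorphicRepData n K hcpt, π.1.IsLAlgebraic ∧
      ∀ᶠ v : HeightOneSpectrum (𝓞 K) in cofinite, SatakeFrobCompatibleAt ι π.1 ρ v) :
    IsResiduallyAutomorphic hcpt ι ρ := by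
  obtain ⟨π, hLπ, hπ⟩ := h
  refine ⟨π, hLπ, ?_⟩
  filter_upwards [hπ] with v ⟨α₀, hα₀, hur, hfrob⟩
  refine ⟨hur, ⟨α₀, hα₀⟩, fun α hα => ?_⟩
  obtain rfl : α = α₀ := AutomorphicRepData.hasSatakeParamAt_unique_holds π.1 hα hα₀
  obtain ⟨P, hP⟩ := hur.exists_hasFrobCharpolyAt_map
  exact ⟨P, P, hP, hfrob.unique hP, rfl⟩

/-- Residually automorphic + W⁺ (irreducible avatar of the congruent π₀) + Lift_w ⟹ automorphic. [g4/g5, re-proved] -/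
theorem automorphic_of_residual (hW : WPlus) (hL : LiftW) (hcpt : isCompact_glFiniteIntegralLevel n K) (hn : 0 < n)
    (ι : PadicAlgCl ℓ ≃+* ℂ) (ρ : FramedGaloisRep K (PadicAlgCl ℓ) n) (hirr : ρ.toGaloisRep.IsIrreducible)
    (hgeo : IsPinnedGeometric ρ) (hres : IsResiduallyAutomorphic hcpt ι ρ) :
    ∃ π : CuspidalAutomorphicRepData n K hcpt, π.1.IsLAlgebraic ∧
      ∀ᶠ v : HeightOneSpectrum (𝓞 K) in cofinite, SatakeFrobCompatibleAt ι π.1 ρ v := by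
  obtain ⟨π₀, hLπ₀, hcong₀⟩ := hres
  obtain ⟨ρ₃, hirr₃, hρ₃⟩ := hW K n hcpt hn π₀ hLπ₀ ℓ ι
  exact hL K n hcpt hn ℓ ι ρ hirr hgeo ⟨π₀, ρ₃, hLπ₀, hirr₃, hρ₃, by
    filter_upwards [hcong₀, hρ₃] with v ⟨_, _, hall⟩ ⟨α, hα, _, hfrob'⟩
    obtain ⟨P, Q, hP, hQ, hPQ⟩ := hall α hα
    exact ⟨P, Q, hP, hQ ▸ hfrob', hPQ⟩⟩

/-- **K IS ATTACKABLE NOW — the certified reduction K ⟸ SD ∧ BC ∧ T⁺.**  Run the tower; over L read EITHER D's induction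
hypothesis at height (k − 1, ℓ) OR the level-move hypothesis at the same height (k, ℓ) — both quantify over every number field;
lift over L (W⁺ + Lift_w), base-change up to the Galois closure M, descend to K, pass to residual automorphy. -/
theorem residualInertiaDescent_of_tower (hSD : SolvableDescent) (hBC : SolvableBaseChange) (hT : ResidualKillingTower) :
    ResidualInertiaDescent := by
  rw [residualInertiaDescent_iff]
  intro hW hL k ℓ _ _ hIH hN K _ _ n hcpt hn ι ρ hirr hgeo hcrys hlev _ hram
  obtain ⟨L, iFL, iNL, iKL, M, iFM, iNM, iKM, iLM, iT, hgalKM, hsolvKM, hirrL, hirrM, hgeoL, hcrysL, hshape⟩ :=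
    hT K n ℓ ρ k hirr hgeo hcrys hlev hram
  have hcptL : isCompact_glFiniteIntegralLevel n L := isCompact_glFiniteIntegralLevel_holds n L
  have hcptM : isCompact_glFiniteIntegralLevel n M := isCompact_glFiniteIntegralLevel_holds n M
  -- Serre_w for ρ|Γ_L: the two exits of the tower
  have hresL : IsResiduallyAutomorphic hcptL ι (ρ.restrictField L) := by
    rcases hshape with hlevL | ⟨hlevL, hnm⟩
    · -- exit 1: w is dead over L — D's induction hypothesis at height (k − 1, ℓ) < (k, ℓ), over the number field L (k ≥ 1)
      have hk : 1 ≤ k := one_le_of_hasLevelAtMost_of_hasRamifiedPlace ρ hlev hram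
      exact hIH (k - 1) ℓ (Or.inl (by omega)) L n hcptL hn ι (ρ.restrictField L) hirrL hgeoL hlevL
    · -- exit 2: only the residual inertia died — ρ|Γ_L is NON-MINIMAL at w′: the level-move class at the same height, over L
      exact hN L n hcptL hn ι (ρ.restrictField L) hirrL hgeoL hcrysL hlevL hnm
  -- W⁺ + Lift_w over L: ρ|Γ_L is automorphic
  have hautL := automorphic_of_residual hW hL hcptL hn ι (ρ.restrictField L) hirrL hgeoL hresL
  -- M/L is Galois solvable (tower top of the Galois solvable M/K)
  haveI : IsGalois L M := IsGalois.tower_top_of_isGalois K L M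
  haveI : IsSolvable (M ≃ₐ[K] M) := hsolvKM
  have hsolvLM : IsSolvable (M ≃ₐ[L] M) :=
    solvable_of_solvable_injective
      (AlgEquiv.restrictScalarsHom_injective K :
        Function.Injective (AlgEquiv.restrictScalarsHom K : (M ≃ₐ[L] M) →* (M ≃ₐ[K] M)))
  -- soluble base change L ↑ M: ρ|Γ_M is automorphic
  have hautM := hBC hW K L M n hcptL hcptM hn ‹IsGalois L M› hsolvLM ℓ ι ρ hirrL hgeoL hirrM hautL
  -- soluble descent M ↓ K (item 29341), then residual automorphy over K
  exact isResiduallyAutomorphic_of_satakeCompatible hcpt ι ρ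
    (hSD hW K n hcpt hn ℓ ι ρ hirr hgeo M hgalKM hsolvKM hcptM hirrM hautM)

/-- The same with the LEDGER ITEM 29341 by name. -/
theorem residualInertiaDescent_of_item (hSD : SolvableReachSplit.SolvableDescent) (hBC : SolvableBaseChange)
    (hT : ResidualKillingTower) : ResidualInertiaDescent :=
  residualInertiaDescent_of_tower (solvableDescent_iff_item.mpr hSD) hBC hT

/-- **U dissolved down to print + one elementary tower + the sibling L**: g5's declared residual follows from SD, BC, T⁺ and L. -/
theorem monodromicDescent_of_tower (hSD : SolvableDescent) (hBC : SolvableBaseChange) (hT : ResidualKillingTower)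
    (hLM : MinimalLevelDescent.LevelMove) : MonodromicDescent :=
  monodromicDescent_of_K_L (residualInertiaDescent_of_tower hSD hBC hT) hLM

/-- M from the line's five leaves: SD → BC → T⁺ → L → Z → M (the registered-skeleton kit `Lines/levelone.lean` proves exactly this
with the leaves as `stub_*`). -/
theorem minimalCrystallineDescent_of_line (hSD : SolvableDescent) (hBC : SolvableBaseChange) (hT : ResidualKillingTower)
    (hLM : MinimalLevelDescent.LevelMove) (hZ : LevelOneCrystallineDescent) : MinimalCrystallineDescent₀ :=
  minimalCrystallineDescent_of_pieces (residualInertiaDescent_of_tower hSD hBC hT) hZ hLM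

/-! ## NECESSITY from the summit: Langlands ⟹ Serre_w ⟹ D ⟹ M ⟹ each piece (kernel certificates) -/

/-- `Langlands ⟹ Serre_w` (conjunct (B) of the summit). [g4, re-proved] -/
theorem residualAutomorphy_of_langlands (hLg : _root_.Langlands) : ResidualSplit.ResidualAutomorphy := by
  intro K _ _ n hcpt hn ℓ _ ι ρ hirr hgeo
  obtain ⟨⟨Rec⟩, h⟩ := hLg K
  obtain ⟨π, hπ, hcorr⟩ := (h Rec n hn hcpt).2 ℓ ι ρ hirr ⟨hgeo.1, fun v hv => hgeo.2 v hv⟩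
  exact isResiduallyAutomorphic_of_satakeCompatible hcpt ι ρ ⟨π, hπ, hcorr.1⟩

/-- `Serre_w ⟹ D`. [g4] -/
theorem descent_of_serre (hS : ResidualSplit.ResidualAutomorphy) : MinimalLevelDescent.LevelPrimeDescent :=
  fun _ _ _ ℓ _ _ _ K _ _ n hcpt hn ι ρ hirr hgeo _ => hS K n hcpt hn ℓ ι ρ hirr hgeo

/-- NECESSITY: Langlands ⟹ D (through Serre_w). [kernel certificate] -/
theorem descent_of_langlands (hLg : _root_.Langlands) : MinimalLevelDescent.LevelPrimeDescent :=
  descent_of_serre (residualAutomorphy_of_langlands hLg)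

/-- NECESSITY: Langlands ⟹ M₀ (record). [kernel certificate] -/
theorem minimal_of_langlands (hLg : _root_.Langlands) : MinimalCrystallineDescent₀ :=
  minimal_of_descent (descent_of_langlands hLg)

/-- NECESSITY: Langlands ⟹ K (stmt-Langlands-31276). [kernel certificate] -/
theorem residualInertiaDescent_of_langlands (hLg : _root_.Langlands) : ResidualInertiaDescent :=
  residualInertiaDescent_of_minimal (minimal_of_langlands hLg)

/-- NECESSITY: Langlands ⟹ Z (stmt-Langlands-31277). [kernel certificate] -/
theorem levelOneCrystallineDescent_of_langlands (hLg : _root_.Langlands) : LevelOneCrystallineDescent :=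
  levelOneCrystallineDescent_of_minimal (minimal_of_langlands hLg)

/-- NECESSITY: Langlands ⟹ W (stmt-Langlands-31274). [kernel certificate] -/
theorem weightMove_of_langlands (hLg : _root_.Langlands) : MinimalLevelDescent.WeightMove :=
  weightMove_of_descent (descent_of_langlands hLg)

/-- NECESSITY: Langlands ⟹ L (stmt-Langlands-31275). [kernel certificate] -/
theorem levelMove_of_langlands (hLg : _root_.Langlands) : MinimalLevelDescent.LevelMove :=
  levelMove_of_descent (descent_of_langlands hLg)

/-! ## DECIDING THEOREM -/

/-- `closes`: K and Z with the two g4 siblings of record give D (`levelPrimeDescent_of_four`, through the LANDED glue 28626), then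
the route of record's deciding theorem `MinimalLevelDescent.closes` verbatim.  Filed shape (operator kit (a)): `route edit
route-Langlands-MinimalLevelDescent --resplit LevelPrimeDescent --into WeightMove LevelMove ResidualInertiaDescent
LevelOneCrystallineDescent` (k = 4; glue `FourGlue`, proof `levelPrimeDescent_of_four`); the route's own `closes` keeps its seven
binders; this ten-binder form is the node's certificate. -/
theorem langlands_of_KZ (hK : ResidualInertiaDescent) (hZ : LevelOneCrystallineDescent)
    (hWM : MinimalLevelDescent.WeightMove) (hLM : MinimalLevelDescent.LevelMove)
    (hB : MinimalLevelDescent.DyadicLevelOneAutomorphy) (hL : MinimalLevelDescent.AutomorphyLifting)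
    (hW : MinimalLevelDescent.SatakeAvatarExistence) (hP : MinimalLevelDescent.PadicMemberCompatibility)
    (hA : MinimalLevelDescent.CompatibilityAwayFromLR) (hR : MinimalLevelDescent.CanonicalReciprocityData) :
    _root_.Langlands :=
  MinimalLevelDescent.closes (levelPrimeDescent_of_four hWM hLM hK hZ) hB hL hW hP hA hR

/-- The same with K opened into its three leaves (SD = item 29341 by name, BC, T⁺): twelve binders, none of them g5's U. -/
theorem langlands_of_tower_KZ (hSD : SolvableReachSplit.SolvableDescent) (hBC : SolvableBaseChange) (hT : ResidualKillingTower)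
    (hZ : LevelOneCrystallineDescent)
    (hWM : MinimalLevelDescent.WeightMove) (hLM : MinimalLevelDescent.LevelMove)
    (hB : MinimalLevelDescent.DyadicLevelOneAutomorphy) (hL : MinimalLevelDescent.AutomorphyLifting)
    (hW : MinimalLevelDescent.SatakeAvatarExistence) (hP : MinimalLevelDescent.PadicMemberCompatibility)
    (hA : MinimalLevelDescent.CompatibilityAwayFromLR) (hR : MinimalLevelDescent.CanonicalReciprocityData) :
    _root_.Langlands :=
  langlands_of_KZ (residualInertiaDescent_of_item hSD hBC hT) hZ hWM hLM hB hL hW hP hA hR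


section Dyadic

variable {p : ℕ} [Fact p.Prime]

/-! ## Bridges (all `Iff.rfl`) -/

/-- C₂'s vocabulary form IS its one-line text over tree declarations. [bookkeeping] -/
theorem dyadicLevelOneCompanion_iff : DyadicLevelOneCompanion ↔
    (∀ (K : Type) [Field K] [NumberField K] (n : ℕ), 0 < n → ∀ (ℓ : ℕ) [Fact ℓ.Prime], ℓ ≠ 2 →
      ∀ (ι : PadicAlgCl ℓ ≃+* ℂ) (ρ : FramedGaloisRep K (PadicAlgCl ℓ) n), ρ.toGaloisRep.IsIrreducible →
        IsPinnedGeometric ρ → IsCrystallineAbove ρ → IsUnramifiedAwayFrom ρ → ∀ (ι₂ : PadicAlgCl 2 ≃+* ℂ),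
          ∃ ρ₂ : FramedGaloisRep K (PadicAlgCl 2) n, ρ₂.toGaloisRep.IsIrreducible ∧ IsPinnedGeometric ρ₂ ∧
            IsUnramifiedAwayFrom ρ₂ ∧ CompanionMatch ι ι₂ ρ ρ₂) :=
  Iff.rfl

/-- E's vocabulary form IS its one-line text over tree declarations (texts.json). [bookkeeping] -/
theorem dyadicCompanionExistence_iff : DyadicCompanionExistence ↔
    (∀ (K : Type) [Field K] [NumberField K] (n : ℕ), 0 < n → ∀ (ℓ : ℕ) [Fact ℓ.Prime], ℓ ≠ 2 →
      ∀ (ι : PadicAlgCl ℓ ≃+* ℂ) (ρ : FramedGaloisRep K (PadicAlgCl ℓ) n), ρ.toGaloisRep.IsIrreducible →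
        IsPinnedGeometric ρ → IsCrystallineAbove ρ → IsUnramifiedAwayFrom ρ → ∀ (ι₂ : PadicAlgCl 2 ≃+* ℂ),
          ∃ ρ₂ : FramedGaloisRep K (PadicAlgCl 2) n, IsPinnedGeometric ρ₂ ∧ CompanionMatch ι ι₂ ρ ρ₂) :=
  Iff.rfl

/-- I's vocabulary form IS its one-line text over tree declarations (texts.json). [bookkeeping] -/
theorem dyadicIrreducibilityTransfer_iff : DyadicIrreducibilityTransfer ↔
    (∀ (K : Type) [Field K] [NumberField K] (n : ℕ), 0 < n → ∀ (ℓ : ℕ) [Fact ℓ.Prime], ℓ ≠ 2 →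
      ∀ (ι : PadicAlgCl ℓ ≃+* ℂ) (ρ : FramedGaloisRep K (PadicAlgCl ℓ) n), ρ.toGaloisRep.IsIrreducible →
        IsPinnedGeometric ρ → IsCrystallineAbove ρ → IsUnramifiedAwayFrom ρ → ∀ (ι₂ : PadicAlgCl 2 ≃+* ℂ)
          (ρ₂ : FramedGaloisRep K (PadicAlgCl 2) n), IsPinnedGeometric ρ₂ → CompanionMatch ι ι₂ ρ ρ₂ →
            ρ₂.toGaloisRep.IsIrreducible) :=
  Iff.rfl

/-- U's vocabulary form IS its one-line text over tree declarations (texts.json). [bookkeeping] -/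
theorem dyadicLevelTransfer_iff : DyadicLevelTransfer ↔
    (∀ (K : Type) [Field K] [NumberField K] (n : ℕ), 0 < n → ∀ (ℓ : ℕ) [Fact ℓ.Prime], ℓ ≠ 2 →
      ∀ (ι : PadicAlgCl ℓ ≃+* ℂ) (ρ : FramedGaloisRep K (PadicAlgCl ℓ) n), ρ.toGaloisRep.IsIrreducible →
        IsPinnedGeometric ρ → IsCrystallineAbove ρ → IsUnramifiedAwayFrom ρ → ∀ (ι₂ : PadicAlgCl 2 ≃+* ℂ)
          (ρ₂ : FramedGaloisRep K (PadicAlgCl 2) n), ρ₂.toGaloisRep.IsIrreducible → IsPinnedGeometric ρ₂ →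
            CompanionMatch ι ι₂ ρ ρ₂ → IsUnramifiedAwayFrom ρ₂) :=
  Iff.rfl

/-! ## Satake/Frobenius bookkeeping -/

/-- `α ↦ arithFrobPolyOfSatake ι q 1 α` is injective (its roots are the `ι⁻¹(a⁻¹)`). [folklore; re-proved from
`roots_arithFrobPolyOfSatake`] -/
theorem arithFrobPolyOfSatake_one_inj (ι : PadicAlgCl ℓ ≃+* ℂ) (q : ℕ) {α β : Multiset ℂ}
    (h : arithFrobPolyOfSatake ι q 1 α = arithFrobPolyOfSatake ι q 1 β) : α = β := by
  have hr := congrArg Polynomial.roots h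
  rw [roots_arithFrobPolyOfSatake, roots_arithFrobPolyOfSatake] at hr
  simp only [pow_zero, one_mul, Nat.sub_self] at hr
  exact Multiset.map_injective (fun a b hab ↦ inv_injective (ι.symm.injective hab)) hr

/-- Two Satake–Frobenius correspondences with one π give a companion matching. -/
theorem companionMatch_of_satake {hcpt : isCompact_glFiniteIntegralLevel n K}
    (π : CuspidalAutomorphicRepData n K hcpt) {ι : PadicAlgCl ℓ ≃+* ℂ} {ι₂ : PadicAlgCl p ≃+* ℂ}
    {ρ : FramedGaloisRep K (PadicAlgCl ℓ) n} {ρ₂ : FramedGaloisRep K (PadicAlgCl p) n}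
    (h₁ : ∀ᶠ v : HeightOneSpectrum (𝓞 K) in cofinite, SatakeFrobCompatibleAt ι π.1 ρ v)
    (h₂ : ∀ᶠ v : HeightOneSpectrum (𝓞 K) in cofinite, SatakeFrobCompatibleAt ι₂ π.1 ρ₂ v) :
    CompanionMatch ι ι₂ ρ ρ₂ := by
  filter_upwards [h₁, h₂] with v ⟨α, hα, _, hfrob⟩ ⟨β, hβ, _, hfrob₂⟩
  obtain rfl : α = β := AutomorphicRepData.hasSatakeParamAt_unique_holds π.1 hα hβ
  exact ⟨α, hfrob, hfrob₂⟩

/-- Matching transports Satake–Frobenius compatibility with π from (ρ, ι) to (ρ₂, ι₂). -/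
theorem eventually_satake_of_match {hcpt : isCompact_glFiniteIntegralLevel n K}
    (π : CuspidalAutomorphicRepData n K hcpt) {ι : PadicAlgCl ℓ ≃+* ℂ} {ι₂ : PadicAlgCl p ≃+* ℂ}
    {ρ : FramedGaloisRep K (PadicAlgCl ℓ) n} {ρ₂ : FramedGaloisRep K (PadicAlgCl p) n}
    (h₁ : ∀ᶠ v : HeightOneSpectrum (𝓞 K) in cofinite, SatakeFrobCompatibleAt ι π.1 ρ v)
    (hm : CompanionMatch ι ι₂ ρ ρ₂) (hur₂ : ∀ᶠ v : HeightOneSpectrum (𝓞 K) in cofinite, ρ₂.IsUnramifiedAt v) :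
    ∀ᶠ v : HeightOneSpectrum (𝓞 K) in cofinite, SatakeFrobCompatibleAt ι₂ π.1 ρ₂ v := by
  filter_upwards [h₁, hm, hur₂] with v ⟨α, hα, _, hfrob⟩ ⟨β, hρβ, hρ₂β⟩ hv₂
  obtain rfl : α = β := arithFrobPolyOfSatake_one_inj ι _ (hfrob.unique hρβ)
  exact ⟨α, hα, hv₂, hρ₂β⟩

/-- … and back from (ρ₂, ι₂) to (ρ, ι). -/
theorem eventually_satake_of_match' {hcpt : isCompact_glFiniteIntegralLevel n K}
    (π : CuspidalAutomorphicRepData n K hcpt) {ι : PadicAlgCl ℓ ≃+* ℂ} {ι₂ : PadicAlgCl p ≃+* ℂ}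
    {ρ : FramedGaloisRep K (PadicAlgCl ℓ) n} {ρ₂ : FramedGaloisRep K (PadicAlgCl p) n}
    (h₂ : ∀ᶠ v : HeightOneSpectrum (𝓞 K) in cofinite, SatakeFrobCompatibleAt ι₂ π.1 ρ₂ v)
    (hm : CompanionMatch ι ι₂ ρ ρ₂) (hur : ∀ᶠ v : HeightOneSpectrum (𝓞 K) in cofinite, ρ.IsUnramifiedAt v) :
    ∀ᶠ v : HeightOneSpectrum (𝓞 K) in cofinite, SatakeFrobCompatibleAt ι π.1 ρ v := by
  filter_upwards [h₂, hm, hur] with v ⟨β, hβ, _, hfrob₂⟩ ⟨α, hρα, hρ₂α⟩ hv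
  obtain rfl : α = β := arithFrobPolyOfSatake_one_inj ι₂ _ (hρ₂α.unique hfrob₂)
  exact ⟨α, hβ, hv, hρα⟩

/-- Two companions ρ₂, ρ₂' of one ρ (both matched through the same (ι, ι₂), both a.e. unramified) share their Frobenius polynomials a.e. -/
theorem eventually_common_of_match {ι : PadicAlgCl ℓ ≃+* ℂ} {ι₂ : PadicAlgCl p ≃+* ℂ} {ρ : FramedGaloisRep K (PadicAlgCl ℓ) n}
    {ρ₂ ρ₂' : FramedGaloisRep K (PadicAlgCl p) n} (hm : CompanionMatch ι ι₂ ρ ρ₂) (hm' : CompanionMatch ι ι₂ ρ ρ₂')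
    (hur : ∀ᶠ v : HeightOneSpectrum (𝓞 K) in cofinite, ρ₂.IsUnramifiedAt v)
    (hur' : ∀ᶠ v : HeightOneSpectrum (𝓞 K) in cofinite, ρ₂'.IsUnramifiedAt v) :
    ∀ᶠ v : HeightOneSpectrum (𝓞 K) in cofinite, ρ₂.IsUnramifiedAt v ∧ ρ₂'.IsUnramifiedAt v ∧
      ∃ P : Polynomial (PadicAlgCl p), ρ₂.HasFrobCharpolyAt v P ∧ ρ₂'.HasFrobCharpolyAt v P := by
  filter_upwards [hm, hm', hur, hur'] with v ⟨α, hρα, hρ₂α⟩ ⟨β, hρβ, hρ₂'β⟩ hv hv'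
  obtain rfl : α = β := arithFrobPolyOfSatake_one_inj ι _ (hρα.unique hρβ)
  exact ⟨hv, hv', _, hρ₂α, hρ₂'β⟩

/-- **Deligne–Serre conjugacy** for an irreducible ρ₁ and any ρ₂ with the same Frobenius polynomials a.e. (Chebotarev + Brauer–Nesbitt,
the tree's proved `FramedGaloisRep.nonempty_equiv_of_hasFrobCharpolyAt_eventually` and `FramedRep.exists_eq_conj_of_equiv`; irreducibility
of ρ₂ first by `IrreducibleOffSector.isIrreducible_of_eventually_hasFrobCharpolyAt_common`). [cite: DeligneSerreASENS1974, Lemme 3.2] -/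
theorem exists_conj_of_match {ρ₁ ρ₂ : FramedGaloisRep K (PadicAlgCl p) n} (hirr₁ : ρ₁.toGaloisRep.IsIrreducible)
    (h : ∀ᶠ v : HeightOneSpectrum (𝓞 K) in cofinite, ρ₁.IsUnramifiedAt v ∧ ρ₂.IsUnramifiedAt v ∧
      ∃ P : Polynomial (PadicAlgCl p), ρ₁.HasFrobCharpolyAt v P ∧ ρ₂.HasFrobCharpolyAt v P) :
    ∃ P : GL (Fin n) (PadicAlgCl p), ρ₂ = FramedRep.conj P ρ₁ := by
  have hirr₂ := Summit.Langlands.Langlands.Theorems.IrreducibleOffSector.isIrreducible_of_eventually_hasFrobCharpolyAt_common hirr₁ h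
  obtain ⟨e⟩ := FramedGaloisRep.nonempty_equiv_of_hasFrobCharpolyAt_eventually chebotarev_artinRep_holds ρ₁ ρ₂
    (Summit.Langlands.Langlands.Theorems.IrreducibleOffSector.isSemisimple_of_isIrreducible ρ₁ hirr₁)
    (Summit.Langlands.Langlands.Theorems.IrreducibleOffSector.isSemisimple_of_isIrreducible ρ₂ hirr₂) h
  exact FramedRep.exists_eq_conj_of_equiv ρ₁ ρ₂ e

omit [NumberField K] in
/-- Unramifiedness away from p is a conjugacy invariant (`FramedGaloisRep.isUnramifiedAt_conj_iff`). -/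
theorem isUnramifiedAwayFrom_conj {ρ₁ : FramedGaloisRep K (PadicAlgCl p) n} (P : GL (Fin n) (PadicAlgCl p))
    (h : IsUnramifiedAwayFrom ρ₁) : IsUnramifiedAwayFrom (FramedRep.conj P ρ₁) :=
  fun w hw => (FramedGaloisRep.isUnramifiedAt_conj_iff w P ρ₁).mpr (h w hw)

end Dyadic

end Summit.Langlands.Langlands.Theorems.LevelOneDyadic
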